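import Mathlib.RingTheory.GradedAlgebra.Homogeneous.Ideal
import Mathlib.RingTheory.Spectrum.Prime.Basic
import Mathlib.AlgebraicGeometry.IdealSheaf.Basic
import Summits.ResolutionOfSingularities.ResolutionOfSingularities.Theorems.WeightedInvariantHomogeneousMinimalPrimes
import HarnessLib

/-!
# Graded-simple orbit charts: a torus-stable closed subset of a closed orbit is empty or the whole orbit

Route `ResolutionOfSingularities/WeightedInvariant`, door crux `HypersurfaceCentreConstruction`
(stmt-ResolutionOfSingularities-19897), e-ladder `e = 1` of `res-L1-w43-stub-10` (cell res-hironaka,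
`D/res-D-pv-025/DOOR-ELADDER-PLAN.md` v1.1 §6, item **T-e1-L0 «orbit extension»**, piece (P-b) of the
2026-08-27T06:29:57Z offer).  The orbit-extension step builds the `e = 1` centre on the torus-stable open
`Ω := act(T × U) ⊇ 𝒬` and must then know that `Ω` contains the WHOLE closed orbit `𝒬`, without any density of
rational points of the torus (finite perfect ground fields are in scope).  In the graded encoding of the torus
action (a `ℤʲ`-grading `𝒜` of the chart ring `A = Γ(Y, W)`, `Theorems.GradedAtlas`), the chart ideal `P` of a
closed orbit with finite stabilisers is **graded-simple**: every homogeneous element of `A` outside `P` is a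
unit modulo `P`.  Pure graded algebra then gives:

* `eq_or_eq_top_of_isHomogeneous_of_gradedSimple` — if `A ⧸ P` is graded-simple in this sense, every
  HOMOGENEOUS ideal `I ⊇ P` is `P` or `⊤` (one homogeneous component of an element of `I ∖ P` lies outside `P`,
  so is a unit mod `P ⊆ I`, whence `1 ∈ I`); `gradedSimple_of_forall_isHomogeneous` — the converse when `P`
  is homogeneous; `radical_eq_or_eq_top_of_gradedSimple`; the prime-spectrum readings
  `zeroLocus_eq_or_eq_empty_of_gradedSimple` (any grading, `√I` homogeneous) and
  `zeroLocus_eq_or_eq_empty_of_gradedSimple_pi` (`ℤʲ`-gradings, `I` homogeneous — radicals of homogeneous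
  ideals are homogeneous, `isHomogeneous_radical`);
* `gradedSimple_of_degreeZero_of_units` — a CRITERION in `GradedAtlas` currency: `P` prime, the degree-`0`
  elements outside `P` are units mod `P`, and there are homogeneous units mod `P` of every degree `e • χ`
  (`e ≠ 0`; the `exponent` / `exists_unit` fields of a graded atlas read on the orbit) ⇒ graded-simple
  (`aᵉ · u` has degree `0` for `u` of degree `e • (-deg a)`);
* the ONE SCHEME SENTENCE, on an affine chart `W : Y.affineOpens` of a scheme `Y` with a grading of `Γ(Y, W)`:
  `closeds_inter_eq_empty_or_eq_zeroLocus_of_gradedSimple` — a closed subset `C` of `Y` with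
  `C ∩ W ⊆ V(P)` whose reduced chart ideal `𝓘(C)(W)` is homogeneous satisfies `C ∩ W = ∅` or
  `C ∩ W = V(P) ∩ W`; `closeds_inter_eq_empty_or_eq_of_gradedSimple` — the same with `V(P) ∩ W = Z ∩ W` for a
  closed `Z ⊇ C` and `P = 𝓘(Z)(W)`; `closeds_inter_eq_empty_of_gradedSimple_of_not_mem` — hence `C ∩ W = ∅` as
  soon as one point of `V(P) ∩ W` (e.g. the generic point of the orbit) is not in `C`.

* ASSEMBLED over an atlas (`closeds_eq_bot_of_gradedSimple_of_cover`,
  `closeds_subset_opens_of_gradedSimple_of_cover`): for `Z` closed irreducible with generic point `η`, covered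
  by affine charts whose reduced chart ideals `𝓘(Z)(W a)` have graded-simple quotients, a closed `C ⊆ Z` with
  homogeneous chart ideals and `η ∉ C` is empty; an open `Ω ∋ η` with `𝓘(Z ∖ Ω)(W a)` homogeneous contains `Z`;
* the two readings of the hypotheses in `GradedAtlas` currency: `isUnit_quotient_mk_of_isUnit_map` (units on
  `Γ(X, X ∩ W)` ⇒ units mod `P ⊇ 𝓘(X)(W)`), `isUnit_quotient_mk_of_exists_degreeZero_inverse`.

This is how T-e1-L0 covers the whole orbit by `act(T × U)`: the complement `𝒬 ∖ Ω` is closed, torus-stable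
(so its reduced chart ideals are homogeneous) and misses `η_𝒬`.  Pure algebra + the affine-chart dictionary
`Scheme.IdealSheafData.vanishingIdeal` / `Scheme.zeroLocus`; nothing here is a claim about Hironaka's problem,
and no statement of H. Hironaka's manuscript is used.  AI-written; weaker than expert review.
-/

noncomputable section

open CategoryTheory AlgebraicGeometry TopologicalSpace

set_option linter.dupNamespace false -- mandated namespace of this single-conjunct summit

namespace Summit.ResolutionOfSingularities.ResolutionOfSingularities.Theorems

universe u

/-! ## §1 Graded-simple quotients: homogeneous ideals over `P` -/

section Algebra

variable {ι σ A : Type*} [CommRing A] [DecidableEq ι] [AddMonoid ι] [SetLike σ A]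
  [AddSubmonoidClass σ A] (𝒜 : ι → σ) [GradedRing 𝒜]

/-- **Over a graded-simple quotient every homogeneous ideal is trivial.**  Let `𝒜` be a grading of the
commutative ring `A` and `P` an ideal such that every homogeneous element of `A` outside `P` is a unit modulo
`P` («`A ⧸ P` is graded-simple»: the chart ring of a closed torus orbit with finite stabilisers).  Then every
homogeneous ideal `I` with `P ≤ I` is `P` or `⊤`: if `x ∈ I ∖ P`, some homogeneous component `xᵢ` of `x` is not
in `P` (else `x = ∑ xᵢ ∈ P`), `xᵢ ∈ I` by homogeneity, and `xᵢ` is a unit mod `P ⊆ I`, so `1 ∈ I`. [folklore] -/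
theorem eq_or_eq_top_of_isHomogeneous_of_gradedSimple {P I : Ideal A}
    (hP : ∀ (i : ι) ⦃a : A⦄, a ∈ 𝒜 i → a ∉ P → IsUnit (Ideal.Quotient.mk P a))
    (hI : I.IsHomogeneous 𝒜) (hPI : P ≤ I) : I = P ∨ I = ⊤ := by
  classical
  by_cases hIP : I ≤ P
  · exact Or.inl (le_antisymm hIP hPI)
  right
  obtain ⟨x, hxI, hxP⟩ := Set.not_subset.mp hIP
  -- some homogeneous component of `x` lies outside `P`
  have hcomp : ∃ i, (DirectSum.decompose 𝒜 x i : A) ∉ P := by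
    by_contra hall
    push Not at hall
    apply hxP
    rw [← DirectSum.sum_support_decompose 𝒜 x]
    exact P.sum_mem fun i _ => hall i
  obtain ⟨i, hi⟩ := hcomp
  have hxiI : (DirectSum.decompose 𝒜 x i : A) ∈ I := hI i hxI
  obtain ⟨v, hv⟩ := (hP i (SetLike.coe_mem _) hi).exists_right_inv
  obtain ⟨d, rfl⟩ := Ideal.Quotient.mk_surjective v
  have hmem : (DirectSum.decompose 𝒜 x i : A) * d - 1 ∈ P := by
    rw [← Ideal.Quotient.eq, map_mul, map_one, hv]
  have h1 : (DirectSum.decompose 𝒜 x i : A) * d - ((DirectSum.decompose 𝒜 x i : A) * d - 1) ∈ I :=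
    I.sub_mem (I.mul_mem_right d hxiI) (hPI hmem)
  rw [Ideal.eq_top_iff_one]
  simpa using h1

/-- **Converse: a homogeneous ideal maximal among homogeneous ideals has graded-simple quotient.**  If `P` is
homogeneous and every homogeneous ideal `I ⊇ P` is `P` or `⊤`, then every homogeneous `a ∉ P` is a unit modulo
`P` (apply the hypothesis to the homogeneous ideal `P + (a) ≠ P`). [folklore] -/
theorem gradedSimple_of_forall_isHomogeneous {P : Ideal A} (hPhom : P.IsHomogeneous 𝒜)
    (h : ∀ I : Ideal A, I.IsHomogeneous 𝒜 → P ≤ I → I = P ∨ I = ⊤) :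
    ∀ (i : ι) ⦃a : A⦄, a ∈ 𝒜 i → a ∉ P → IsUnit (Ideal.Quotient.mk P a) := by
  intro i a hai haP
  have hIhom : (Ideal.span {a} ⊔ P).IsHomogeneous 𝒜 :=
    (Ideal.homogeneous_span 𝒜 {a} fun x hx => by
      rw [Set.mem_singleton_iff.mp hx]; exact ⟨i, hai⟩).sup hPhom
  rcases h _ hIhom le_sup_right with hIP | hItop
  · exact absurd (hIP.le (Ideal.mem_sup_left (Ideal.mem_span_singleton_self a))) haP
  · obtain ⟨c, b, hb, hcb⟩ := Ideal.mem_span_singleton_sup.mp (hItop.symm ▸ Submodule.mem_top : (1 : A) ∈ _)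
    refine IsUnit.of_mul_eq_one_right (Ideal.Quotient.mk P c) ?_
    rw [← map_mul, ← map_one (Ideal.Quotient.mk P), Ideal.Quotient.eq]
    rw [← hcb]
    simpa using P.neg_mem hb

/-- **Radical form.**  Over a graded-simple quotient `A ⧸ P`, an ideal `I` whose radical is homogeneous and
contains `P` has `√I = P` or `I = ⊤`. [folklore] -/
theorem radical_eq_or_eq_top_of_gradedSimple {P I : Ideal A}
    (hP : ∀ (i : ι) ⦃a : A⦄, a ∈ 𝒜 i → a ∉ P → IsUnit (Ideal.Quotient.mk P a))
    (hI : I.radical.IsHomogeneous 𝒜) (hPI : P ≤ I.radical) : I.radical = P ∨ I = ⊤ := by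
  rcases eq_or_eq_top_of_isHomogeneous_of_gradedSimple 𝒜 hP hI hPI with h | h
  · exact Or.inl h
  · exact Or.inr (Ideal.radical_eq_top.mp h)

/-- **Prime-spectrum reading.**  Over a graded-simple quotient `A ⧸ P`, a closed subset `V(I)` of `V(P)` in
`Spec A` whose radical ideal `√I` is homogeneous is `V(P)` or empty. [folklore] -/
theorem zeroLocus_eq_or_eq_empty_of_gradedSimple {P I : Ideal A}
    (hP : ∀ (i : ι) ⦃a : A⦄, a ∈ 𝒜 i → a ∉ P → IsUnit (Ideal.Quotient.mk P a))
    (hI : I.radical.IsHomogeneous 𝒜)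
    (h : PrimeSpectrum.zeroLocus (I : Set A) ⊆ PrimeSpectrum.zeroLocus (P : Set A)) :
    PrimeSpectrum.zeroLocus (I : Set A) = PrimeSpectrum.zeroLocus (P : Set A) ∨
      PrimeSpectrum.zeroLocus (I : Set A) = ∅ := by
  rw [PrimeSpectrum.zeroLocus_subset_zeroLocus_iff] at h
  rcases radical_eq_or_eq_top_of_gradedSimple 𝒜 hP hI h with hrad | htop
  · left
    rw [← PrimeSpectrum.zeroLocus_radical I, hrad]
  · right
    exact PrimeSpectrum.zeroLocus_empty_iff_eq_top.mpr htop

end Algebra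

/-! ## §2 `ℤʲ`-gradings: radicals are homogeneous for free -/

section Pi

variable {j : ℕ} {A : Type*} [CommRing A] (𝒜 : (Fin j → ℤ) → AddSubgroup A) [GradedRing 𝒜]

/-- **Prime-spectrum reading, `ℤʲ`-gradings.**  For a `ℤʲ`-grading (the torus charts of the door) and a
graded-simple quotient `A ⧸ P`, a closed subset `V(I) ⊆ V(P)` of `Spec A` cut out by a HOMOGENEOUS ideal `I`
is `V(P)` or empty (the radical of a homogeneous ideal is homogeneous, `isHomogeneous_radical`). [folklore] -/
theorem zeroLocus_eq_or_eq_empty_of_gradedSimple_pi {P I : Ideal A}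
    (hP : ∀ (χ : Fin j → ℤ) ⦃a : A⦄, a ∈ 𝒜 χ → a ∉ P → IsUnit (Ideal.Quotient.mk P a))
    (hI : I.IsHomogeneous 𝒜)
    (h : PrimeSpectrum.zeroLocus (I : Set A) ⊆ PrimeSpectrum.zeroLocus (P : Set A)) :
    PrimeSpectrum.zeroLocus (I : Set A) = PrimeSpectrum.zeroLocus (P : Set A) ∨
      PrimeSpectrum.zeroLocus (I : Set A) = ∅ :=
  zeroLocus_eq_or_eq_empty_of_gradedSimple 𝒜 hP (isHomogeneous_radical 𝒜 hI) h

/-- **Homogeneous ideals over a graded-simple `ℤʲ`-graded quotient, element form**: if `I ⊇ P` is homogeneous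
and contains an element outside `P`, then `I = ⊤`. [folklore] -/
theorem eq_top_of_isHomogeneous_of_gradedSimple_pi {P I : Ideal A}
    (hP : ∀ (χ : Fin j → ℤ) ⦃a : A⦄, a ∈ 𝒜 χ → a ∉ P → IsUnit (Ideal.Quotient.mk P a))
    (hI : I.IsHomogeneous 𝒜) (hPI : P ≤ I) {x : A} (hxI : x ∈ I) (hxP : x ∉ P) : I = ⊤ := by
  rcases eq_or_eq_top_of_isHomogeneous_of_gradedSimple 𝒜 hP hI hPI with h | h
  · exact absurd (h.le hxI) hxP
  · exact h

end Pi

/-! ## §3 A criterion for graded-simplicity in `GradedAtlas` currency -/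

section Criterion

variable {ι σ A : Type*} [CommRing A] [DecidableEq ι] [AddCommGroup ι] [SetLike σ A]
  [AddSubmonoidClass σ A] (𝒜 : ι → σ) [GradedRing 𝒜]

/-- **Criterion for a graded-simple quotient** (closed orbit with finite stabilisers, read in the graded
encoding of `Theorems.GradedAtlas`: `exponent = e`, `exists_unit` = homogeneous units of all degrees `e • χ`).
Let `𝒜` be a grading of `A` by an additive commutative group and `P` a prime ideal such that
(i) every degree-`0` element outside `P` is a unit modulo `P`, and (ii) for some `e ≠ 0` and every degree `χ`
there is a homogeneous element of degree `e • χ` that is a unit modulo `P`.  Then every homogeneous `a ∉ P`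
is a unit modulo `P`: for `a` of degree `χ` and `u` of degree `e • (-χ)` a unit mod `P`, the element `aᵉ · u`
has degree `0` and lies outside the prime `P`, so is a unit mod `P`; hence so are `aᵉ` and `a`. [folklore] -/
theorem gradedSimple_of_degreeZero_of_units {P : Ideal A} [hPprime : P.IsPrime]
    (h0 : ∀ ⦃a : A⦄, a ∈ 𝒜 0 → a ∉ P → IsUnit (Ideal.Quotient.mk P a))
    {e : ℕ} (he : e ≠ 0) (hu : ∀ χ : ι, ∃ u ∈ 𝒜 (e • χ), IsUnit (Ideal.Quotient.mk P u)) :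
    ∀ (χ : ι) ⦃a : A⦄, a ∈ 𝒜 χ → a ∉ P → IsUnit (Ideal.Quotient.mk P a) := by
  intro χ a haχ haP
  obtain ⟨u, huχ, huunit⟩ := hu (-χ)
  have hae : a ^ e ∈ 𝒜 (e • χ) := SetLike.pow_mem_graded e haχ
  have hprod : a ^ e * u ∈ 𝒜 0 := by
    have hmul := SetLike.mul_mem_graded hae huχ
    rwa [smul_neg, add_neg_cancel] at hmul
  have huP : u ∉ P := by
    intro huP'
    rw [Ideal.Quotient.eq_zero_iff_mem.mpr huP', isUnit_zero_iff] at huunit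
    exact hPprime.ne_top (Ideal.Quotient.zero_eq_one_iff.mp huunit)
  have haeP : a ^ e * u ∉ P := fun hmem =>
    (hPprime.mem_or_mem hmem).elim (fun h' => haP (hPprime.mem_of_pow_mem e h')) huP
  have hunit := h0 hprod haeP
  rw [map_mul, IsUnit.mul_iff, map_pow, isUnit_pow_iff he] at hunit
  exact hunit.1

/-- **Units modulo `P` from units on a quotient.**  If `g : A →+* B` is surjective with `ker g ≤ P` and
`g s` is a unit, then `s` is a unit modulo `P` (lift the inverse along `g`).  This is how hypothesis (ii) of
`gradedSimple_of_degreeZero_of_units` is read off `GradedAtlas.exists_unit` (units of the sections on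
`X ∩ W`, `Γ(Y, W) → Γ(X, X ∩ W)` surjective for a closed immersion into an affine chart, `𝓘(X)(W) ≤ P` for an
orbit inside `X`). [folklore] -/
theorem isUnit_quotient_mk_of_isUnit_map {B : Type*} [CommRing B] (g : A →+* B)
    (hg : Function.Surjective g) {P : Ideal A} (hgP : RingHom.ker g ≤ P) {s : A} (hs : IsUnit (g s)) :
    IsUnit (Ideal.Quotient.mk P s) := by
  obtain ⟨v, hv⟩ := hs.exists_right_inv
  obtain ⟨t, rfl⟩ := hg v
  refine IsUnit.of_mul_eq_one (Ideal.Quotient.mk P t) ?_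
  rw [← map_mul, ← map_one (Ideal.Quotient.mk P), Ideal.Quotient.eq]
  apply hgP
  rw [RingHom.mem_ker, map_sub, map_mul, hv, map_one, sub_self]

omit [DecidableEq ι] [AddSubmonoidClass σ A] [GradedRing 𝒜] in
/-- **Degree-`0` units modulo `P` from a maximal contraction.**  If the elements of degree `0` lying in `P`
form a maximal ideal of the degree-`0` subring — phrased without the subring structure: every degree-`0`
element outside `P` has a degree-`0` inverse modulo `P` — then hypothesis (i) of
`gradedSimple_of_degreeZero_of_units` holds.  (For a graded atlas: the degree-`0` sections are the functions
on the quotient chart `U`, and those vanishing on the closed orbit `q⁻¹(v)` are the maximal ideal of the closed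
point `v`.) [folklore] -/
theorem isUnit_quotient_mk_of_exists_degreeZero_inverse {P : Ideal A} {a : A}
    (h : ∃ b ∈ 𝒜 0, a * b - 1 ∈ P) : IsUnit (Ideal.Quotient.mk P a) := by
  obtain ⟨b, -, hb⟩ := h
  refine IsUnit.of_mul_eq_one (Ideal.Quotient.mk P b) ?_
  rw [← map_mul, ← map_one (Ideal.Quotient.mk P), Ideal.Quotient.eq]
  exact hb

end Criterion


/-! ## §4 The scheme sentence on an affine chart -/

section SchemeSentence

variable {Y : Scheme.{u}} (W : Y.affineOpens) {ι σ : Type*} [DecidableEq ι] [AddMonoid ι]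
  [SetLike σ Γ(Y, W)] [AddSubmonoidClass σ Γ(Y, W)] (𝒜 : ι → σ) [GradedRing 𝒜]

open Scheme.IdealSheafData

/-- **Affine-chart dictionary**: a closed subset `C` of a scheme `Y` meets an affine open `W` in the zero set
of its reduced chart ideal `𝓘(C)(W)` (`Scheme.IdealSheafData.vanishingIdeal`). [folklore] -/
theorem closeds_inter_eq_zeroLocus_vanishingIdeal (C : Closeds Y) :
    (C : Set Y) ∩ W = Y.zeroLocus (U := W) ((vanishingIdeal C).ideal W) ∩ W := by
  have h := (vanishingIdeal C).coe_support_inter W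
  rwa [coe_support_vanishingIdeal] at h

/-- **Affine-chart dictionary**: if `C ∩ W` lies in the zero set of an ideal `P` of `Γ(Y, W)`, then
`P ≤ 𝓘(C)(W)`. [folklore] -/
theorem le_vanishingIdeal_ideal_of_inter_subset_zeroLocus (C : Closeds Y) {P : Ideal Γ(Y, W)}
    (hCP : (C : Set Y) ∩ W ⊆ Y.zeroLocus (U := W) P) : P ≤ (vanishingIdeal C).ideal W := by
  intro f hf
  rw [vanishingIdeal_ideal, PrimeSpectrum.mem_vanishingIdeal]
  intro p hp
  have hpW : W.2.fromSpec p ∈ (W : Set Y) := by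
    rw [← IsAffineOpen.range_fromSpec W.2]
    exact Set.mem_range_self p
  have hpP : p ∈ W.2.fromSpec ⁻¹' Y.zeroLocus (U := W) (P : Set Γ(Y, W)) := hCP ⟨hp, hpW⟩
  rw [W.2.fromSpec_preimage_zeroLocus] at hpP
  exact hpP hf

/-- **The scheme sentence: a closed subset of a graded-simple orbit chart with homogeneous ideal is empty or
everything.**  Let `W` be an affine open of a scheme `Y`, `𝒜` a grading of `Γ(Y, W)` and `P` an ideal of
`Γ(Y, W)` with graded-simple quotient (every homogeneous section outside `P` is a unit modulo `P` — the chart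
of a closed torus orbit with finite stabilisers).  If `C ⊆ Y` is closed with `C ∩ W ⊆ V(P)` and the reduced
chart ideal `𝓘(C)(W)` is homogeneous (e.g. `C` torus-stable), then `C ∩ W = ∅` or `C ∩ W = V(P) ∩ W`.
[folklore] -/
theorem closeds_inter_eq_empty_or_eq_zeroLocus_of_gradedSimple {P : Ideal Γ(Y, W)}
    (hP : ∀ (i : ι) ⦃a : Γ(Y, W)⦄, a ∈ 𝒜 i → a ∉ P → IsUnit (Ideal.Quotient.mk P a))
    (C : Closeds Y) (hC : ((vanishingIdeal C).ideal W).IsHomogeneous 𝒜)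
    (hCP : (C : Set Y) ∩ W ⊆ Y.zeroLocus (U := W) P) :
    (C : Set Y) ∩ W = ∅ ∨ (C : Set Y) ∩ W = Y.zeroLocus (U := W) P ∩ W := by
  rcases eq_or_eq_top_of_isHomogeneous_of_gradedSimple 𝒜 hP hC
      (le_vanishingIdeal_ideal_of_inter_subset_zeroLocus W C hCP) with h | h
  · right
    rw [closeds_inter_eq_zeroLocus_vanishingIdeal W C, h]
  · left
    rw [closeds_inter_eq_zeroLocus_vanishingIdeal W C, h, Submodule.top_coe, Scheme.zeroLocus_univ,
      Set.compl_inter_self]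

/-- **The scheme sentence, two closed sets.**  With `Z ⊆ Y` closed, `P := 𝓘(Z)(W)` graded-simple and
`C ⊆ Z` closed with homogeneous `𝓘(C)(W)`: `C ∩ W = ∅` or `C ∩ W = Z ∩ W`. [folklore] -/
theorem closeds_inter_eq_empty_or_eq_of_gradedSimple (C Z : Closeds Y) (hCZ : C ≤ Z)
    (hP : ∀ (i : ι) ⦃a : Γ(Y, W)⦄, a ∈ 𝒜 i → a ∉ (vanishingIdeal Z).ideal W →
      IsUnit (Ideal.Quotient.mk ((vanishingIdeal Z).ideal W) a))
    (hC : ((vanishingIdeal C).ideal W).IsHomogeneous 𝒜) :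
    (C : Set Y) ∩ W = ∅ ∨ (C : Set Y) ∩ W = (Z : Set Y) ∩ W := by
  have hZ := closeds_inter_eq_zeroLocus_vanishingIdeal W Z
  have hCP : (C : Set Y) ∩ W ⊆ Y.zeroLocus (U := W) ((vanishingIdeal Z).ideal W) := by
    intro y hy
    have hyZ : y ∈ (Z : Set Y) ∩ W := ⟨hCZ hy.1, hy.2⟩
    rw [hZ] at hyZ
    exact hyZ.1
  rcases closeds_inter_eq_empty_or_eq_zeroLocus_of_gradedSimple W 𝒜 hP C hC hCP with h | h
  · exact Or.inl h
  · exact Or.inr (h.trans hZ.symm)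

/-- **Pointed form: a torus-stable closed subset of the orbit chart missing one point of the orbit misses the
chart.**  In the situation of `closeds_inter_eq_empty_or_eq_zeroLocus_of_gradedSimple`, if some point of
`V(P) ∩ W` (e.g. the generic point of the orbit) is not in `C`, then `C ∩ W = ∅`. [folklore] -/
theorem closeds_inter_eq_empty_of_gradedSimple_of_not_mem {P : Ideal Γ(Y, W)}
    (hP : ∀ (i : ι) ⦃a : Γ(Y, W)⦄, a ∈ 𝒜 i → a ∉ P → IsUnit (Ideal.Quotient.mk P a))
    (C : Closeds Y) (hC : ((vanishingIdeal C).ideal W).IsHomogeneous 𝒜)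
    (hCP : (C : Set Y) ∩ W ⊆ Y.zeroLocus (U := W) P)
    {y : Y} (hyW : y ∈ (W : Set Y)) (hyP : y ∈ Y.zeroLocus (U := W) (P : Set Γ(Y, W))) (hyC : y ∉ C) :
    (C : Set Y) ∩ W = ∅ := by
  rcases closeds_inter_eq_empty_or_eq_zeroLocus_of_gradedSimple W 𝒜 hP C hC hCP with h | h
  · exact h
  · have hy : y ∈ (C : Set Y) ∩ W := by rw [h]; exact ⟨hyP, hyW⟩
    exact absurd hy.1 hyC

/-- **Pointed form, two closed sets**: `C ⊆ Z` closed, `𝓘(Z)(W)` graded-simple, `𝓘(C)(W)` homogeneous and a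
point of `Z ∩ W` outside `C` ⇒ `C ∩ W = ∅`. [folklore] -/
theorem closeds_inter_eq_empty_of_gradedSimple_of_not_mem' (C Z : Closeds Y) (hCZ : C ≤ Z)
    (hP : ∀ (i : ι) ⦃a : Γ(Y, W)⦄, a ∈ 𝒜 i → a ∉ (vanishingIdeal Z).ideal W →
      IsUnit (Ideal.Quotient.mk ((vanishingIdeal Z).ideal W) a))
    (hC : ((vanishingIdeal C).ideal W).IsHomogeneous 𝒜)
    {y : Y} (hyW : y ∈ (W : Set Y)) (hyZ : y ∈ Z) (hyC : y ∉ C) : (C : Set Y) ∩ W = ∅ := by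
  rcases closeds_inter_eq_empty_or_eq_of_gradedSimple W 𝒜 C Z hCZ hP hC with h | h
  · exact h
  · have hy : y ∈ (C : Set Y) ∩ W := by rw [h]; exact ⟨hyZ, hyW⟩
    exact absurd hy.1 hyC

end SchemeSentence

/-! ## §5 Assembled over an atlas: torus-stable opens swallow closed orbits -/

section Cover

variable {Y : Scheme.{u}} {α : Type*} (W : α → Y.affineOpens) {ι : Type*} [DecidableEq ι] [AddMonoid ι]
  {σ : α → Type*} [∀ a, SetLike (σ a) Γ(Y, W a)] [∀ a, AddSubmonoidClass (σ a) Γ(Y, W a)]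
  (𝒜 : ∀ a, ι → σ a) [∀ a, GradedRing (𝒜 a)]

open Scheme.IdealSheafData

/-- **A closed subset with homogeneous chart ideals inside an irreducible closed set with graded-simple chart
ideals is empty once it misses the generic point.**  Let `Z ⊆ Y` be closed and irreducible with generic point
`η`, covered by affine charts `W a` carrying gradings `𝒜 a` of `Γ(Y, W a)` for which the reduced chart ideals
`𝓘(Z)(W a)` have graded-simple quotients (a closed torus orbit with finite stabilisers, read chart by chart),
and let `C ⊆ Z` be closed with every `𝓘(C)(W a)` homogeneous (a torus-stable closed subset).  If `η ∉ C` then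
`C = ∅`: every chart meeting `Z` contains `η`, so `closeds_inter_eq_empty_of_gradedSimple_of_not_mem'` empties
`C` chart by chart. [folklore] -/
theorem closeds_eq_bot_of_gradedSimple_of_cover (C Z : Closeds Y) (hCZ : C ≤ Z) {η : Y}
    (hη : IsGenericPoint η (Z : Set Y)) (hηC : η ∉ C)
    (hcov : (Z : Set Y) ⊆ ⋃ a, ((W a : Y.Opens) : Set Y))
    (hP : ∀ a (i : ι) ⦃s : Γ(Y, W a)⦄, s ∈ 𝒜 a i → s ∉ (vanishingIdeal Z).ideal (W a) →
      IsUnit (Ideal.Quotient.mk ((vanishingIdeal Z).ideal (W a)) s))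
    (hC : ∀ a, ((vanishingIdeal C).ideal (W a)).IsHomogeneous (𝒜 a)) : C = ⊥ := by
  apply Closeds.ext
  rw [Closeds.coe_bot, Set.eq_empty_iff_forall_notMem]
  intro y hyC
  obtain ⟨a, hya⟩ := Set.mem_iUnion.mp (hcov (hCZ hyC))
  have hηW : η ∈ ((W a : Y.Opens) : Set Y) :=
    (hη.mem_open_set_iff (W a).1.isOpen).mpr ⟨y, hCZ hyC, hya⟩
  have hempty := closeds_inter_eq_empty_of_gradedSimple_of_not_mem' (W a) (𝒜 a) C Z hCZ (hP a) (hC a)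
    hηW hη.mem hηC
  have hy : y ∈ (C : Set Y) ∩ (W a : Y.Opens) := ⟨hyC, hya⟩
  rw [hempty] at hy
  exact hy

/-- **Torus-stable opens swallow closed orbits** (the form T-e1-L0 uses for `Ω := act(T × U) ⊇ 𝒬`).  Let
`Z ⊆ Y` be closed and irreducible with generic point `η`, covered by affine charts `W a` with gradings for
which the chart ideals `𝓘(Z)(W a)` have graded-simple quotients, and let `Ω ⊆ Y` be an open containing `η` such
that the closed set `Z ∖ Ω` has homogeneous reduced chart ideals `𝓘(Z ⊓ Ωᶜ)(W a)` (e.g. `Ω` torus-stable).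
Then `Z ⊆ Ω`. [folklore] -/
theorem closeds_subset_opens_of_gradedSimple_of_cover (Z : Closeds Y) (Ω : Y.Opens) {η : Y}
    (hη : IsGenericPoint η (Z : Set Y)) (hηΩ : η ∈ Ω)
    (hcov : (Z : Set Y) ⊆ ⋃ a, ((W a : Y.Opens) : Set Y))
    (hP : ∀ a (i : ι) ⦃s : Γ(Y, W a)⦄, s ∈ 𝒜 a i → s ∉ (vanishingIdeal Z).ideal (W a) →
      IsUnit (Ideal.Quotient.mk ((vanishingIdeal Z).ideal (W a)) s))
    (hC : ∀ a, ((vanishingIdeal (Z ⊓ Ω.compl)).ideal (W a)).IsHomogeneous (𝒜 a)) :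
    (Z : Set Y) ⊆ Ω := by
  have hbot := closeds_eq_bot_of_gradedSimple_of_cover W 𝒜 (Z ⊓ Ω.compl) Z inf_le_left hη
    (fun h => by
      rw [← SetLike.mem_coe, Closeds.coe_inf, Opens.coe_compl] at h
      exact h.2 hηΩ) hcov hP hC
  intro y hyZ
  by_contra hyΩ
  have hy : y ∈ ((Z ⊓ Ω.compl : Closeds Y) : Set Y) := by
    rw [Closeds.coe_inf, Opens.coe_compl]; exact ⟨hyZ, hyΩ⟩
  rw [hbot, Closeds.coe_bot] at hy
  exact hy

end Cover

end Summit.ResolutionOfSingularities.ResolutionOfSingularities.Theorems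

end
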